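import Summits.CriticalPhenomena.PercolationContinuityZ3.Theorems.PercNearOneGluingNoHeavyLowerTailDualBHKEA
import HarnessLib

/-!
# Dual BHK inequality — Theorem 2: the family `MASTER(M, M′, 𝔐; X, Y, N)` and `BT₀`

Support file 7/8 for the dual BHK inequality `u_b·u_c ≥ t·n′_a` (memo `prim-ineq-gen-2/DUAL-BHK.md` §8, Theorem 2;
`--supports stmt-CriticalPhenomena-4575`).  For every finite weighted graph (random edges `D`, weights `p ∈ [0,1]`, forced edges
`F`, support `E ⊇ D ∪ F`), every universe `U ∋ a` and vertex sets `M, M′ ⊆ 𝔐 ⊆ U`, `X, Y ⊆ N ⊆ U`: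

  `master_univ`:  `t(M,X) · q⁺(M′ ∪ Y; 𝔐, N) ≤ Ξ(M ∪ M′; X ∩ Y) · Ξ(X ∪ Y; M ∩ M′)`.

PROOF (memo): strong induction on `U`.  A vertex `v ∈ X ∩ Y ∖ (𝔐 ∪ {a})` is peeled with `ad_step` (`peel_c`); a vertex
`v ∈ M ∩ M′ ∖ (N ∪ {a})` likewise after exchanging the two sides (`MASTER` is symmetric under `(M,M′,𝔐) ↔ (X,Y,N)` with the
two right-hand factors exchanged); if `X ∩ Y` or `M ∩ M′` is nonempty but not peelable, factor 2 vanishes (a vertex of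
`𝔐 ∩ N`, or `a`, is avoided).  Base type `X ∩ Y = M ∩ M′ = ∅`: the right side is `≥ h(M) h(X) = (Ξ(M;X)+α)(Ξ(X;M)+β)` and the
left side is `≤ t · P(Sep(M,X)) ≤ t (q₀ + g₁ + g₂ + g₃)`; the four brackets are the non-base instance `MASTER(M,M,M;X,X,X)`,
`EA(M;X,X,X)`, `EA(X;M,M,M)` (Theorem 1) and `(E-c)`.  Corollary `bt0`: `t(M,X) · P(C_a separates M from X) ≤ h(M) · h(X)`.
[this work]
-/

namespace Summit.CriticalPhenomena.PercolationContinuityZ3.Theorems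

namespace DualBHK

open SimpleGraph Finset Literature.Probability.Percolation.DecisionTree

variable {V : Type*} [DecidableEq V]

section Master

variable {D F E : Finset (Sym2 V)} {p : Sym2 V → ℝ} {a : V}

/-- The exchange symmetry of factor 2: `q⁺(M′ ∪ Y; 𝔐, N) = q⁺(Y ∪ M′; N, 𝔐)`. [this work] -/
theorem evQp_swap (U : Finset V) (M' Y MM N : Set V) :
    evQp U E F a (M' ∪ Y) MM N = evQp U E F a (Y ∪ M') N MM := by
  ext S
  simp only [mem_evQp, Set.union_comm M' Y, sepEv_comm MM N]

/-- **Lemma E(i)**: `P(A ∪ B) · P(A ∩ B) ≤ P(A) · P(B)` (the difference is `(P A − P(A∩B))(P B − P(A∩B))`). [folklore] -/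
theorem PrW_union_mul_inter_le (hp0 : ∀ e, 0 ≤ p e) (hp1 : ∀ e, p e ≤ 1) (A B : Set (Finset (Sym2 V))) :
    PrW D p (A ∪ B) * PrW D p (A ∩ B) ≤ PrW D p A * PrW D p B := by
  have h := PrW_union_add_inter D p A B
  have hA : PrW D p (A ∩ B) ≤ PrW D p A := PrW_mono D hp0 hp1 fun S _ hS => hS.1
  have hB : PrW D p (A ∩ B) ≤ PrW D p B := PrW_mono D hp0 hp1 fun S _ hS => hS.2
  have h2 : 0 ≤ (PrW D p A - PrW D p (A ∩ B)) * (PrW D p B - PrW D p (A ∩ B)) :=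
    mul_nonneg (sub_nonneg.2 hA) (sub_nonneg.2 hB)
  have h3 : PrW D p (A ∪ B) = PrW D p A + PrW D p B - PrW D p (A ∩ B) := by linarith
  have h4 : PrW D p A * PrW D p B - PrW D p (A ∪ B) * PrW D p (A ∩ B) =
      (PrW D p A - PrW D p (A ∩ B)) * (PrW D p B - PrW D p (A ∩ B)) := by rw [h3]; ring
  linarith

/-- **Theorem 2 (family `MASTER`)** of the memo: `t(M,X) · q⁺(M′∪Y;𝔐,N) ≤ Ξ(M∪M′;X∩Y) · Ξ(X∪Y;M∩M′)` for all
`M, M′ ⊆ 𝔐 ⊆ U`, `X, Y ⊆ N ⊆ U`, `a ∈ U`. [this work] -/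
theorem master_univ (hp0 : ∀ e, 0 ≤ p e) (hp1 : ∀ e, p e ≤ 1) (hDE : D ⊆ E) (hFE : F ⊆ E) (U : Finset V) :
    ∀ (M M' MM X Y N : Set V), a ∈ U → MM ⊆ ↑U → N ⊆ ↑U → M ⊆ MM → M' ⊆ MM → X ⊆ N → Y ⊆ N →
      PrW D p (evT U F a M X) * PrW D p (evQp U E F a (M' ∪ Y) MM N) ≤
        PrW D p (evXi U F a (M ∪ M') (X ∩ Y)) * PrW D p (evXi U F a (X ∪ Y) (M ∩ M')) := by
  induction U using Finset.strongInduction with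
  | H U ih =>
  have hnn : ∀ X : Set (Finset (Sym2 V)), 0 ≤ PrW D p X := fun X => PrW_nonneg D hp0 hp1 X
  /- Peeling a vertex `v ∈ X ∩ Y`, `v ∉ 𝔐 ∪ {a}`. -/
  have peel_c : ∀ (M M' MM X Y N : Set V), a ∈ U → MM ⊆ ↑U → N ⊆ ↑U → M ⊆ MM → M' ⊆ MM → X ⊆ N →
      Y ⊆ N → ∀ v, v ∈ X → v ∈ Y → v ∉ MM → v ≠ a →
      PrW D p (evT U F a M X) * PrW D p (evQp U E F a (M' ∪ Y) MM N) ≤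
        PrW D p (evXi U F a (M ∪ M') (X ∩ Y)) * PrW D p (evXi U F a (X ∪ Y) (M ∩ M')) := by
    intro M M' MM X Y N haU hMMU hNU hM hM' hXN hYN v hvX hvY hvMM hva
    have hav : a ≠ v := fun h => hva h.symm
    have hvM : v ∉ M := fun h => hvMM (hM h)
    have hvM' : v ∉ M' := fun h => hvMM (hM' h)
    have hvN : v ∈ N := hYN hvY
    have hvU : v ∈ U := hNU hvN
    have hss : U.erase v ⊂ U := Finset.erase_ssubset hvU
    have haU' : a ∈ U.erase v := Finset.mem_erase.2 ⟨hav, haU⟩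
    have hMMU' : MM ⊆ ↑(U.erase v) := fun m hm => by
      rw [Finset.coe_erase]
      exact ⟨hMMU hm, fun h => hvMM (by rw [Set.mem_singleton_iff.1 h] at hm; exact hm)⟩
    have hN1 : (N \ {v}) ∪ Kset U E v ⊆ ↑(U.erase v) := by
      rintro d (⟨hdN, hdv⟩ | hdK)
      · rw [Finset.coe_erase]; exact ⟨hNU hdN, hdv⟩
      · rw [Finset.coe_erase]; exact ⟨hdK.1, fun h => hdK.2.1 (Set.mem_singleton_iff.1 h)⟩
    have hvMY : v ∈ M' ∪ Y := Or.inr hvY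
    have hvA : v ∉ M ∪ M' := by
      rintro (h | h)
      · exact hvM h
      · exact hvM' h
    have hvB : v ∉ M ∩ M' := fun h => hvM h.1
    refine ad_step hp0 hp1 hDE hFE U v _ _ _ _
      (fun K => evT (U.erase v) F a M ((X \ {v}) ∪ K))
      (fun K => evQp (U.erase v) E F a (((M' ∪ Y) \ {v}) ∪ K) MM ((N \ {v}) ∪ Kset U E v))
      (fun K => evXi (U.erase v) F a (M ∪ M') (((X ∩ Y) \ {v}) ∪ K))
      (fun K => evXi (U.erase v) F a (((X ∪ Y) \ {v}) ∪ K) (M ∩ M'))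
      (fun S _ => mem_evT_peel_iff hvU hav hvX hvM)
      (fun S _ => mem_evQp_peel_iff hvU hav hvMY hvMM hvN)
      (fun S _ => mem_evXi_peel_avoid_iff hvU hav ⟨hvX, hvY⟩ hvA)
      (fun S _ => mem_evXi_peel_hub_iff hvU hav (Or.inl hvX) hvB)
      (fun K T R hT => union_mem_evT_erase_iff hT R M _)
      (fun K T R hT => union_mem_evQp_erase_iff hT R _ MM _)
      (fun K T R hT => union_mem_evXi_erase_iff hT R _ _)
      (fun K T R hT => union_mem_evXi_erase_iff hT R _ _)
      ?_
    intro K K' hK hK'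
    have hX1 : (X \ {v}) ∪ K ⊆ (N \ {v}) ∪ Kset U E v :=
      Set.union_subset_union (Set.sdiff_subset_sdiff_left hXN) hK
    have hY1 : (Y \ {v}) ∪ K' ⊆ (N \ {v}) ∪ Kset U E v :=
      Set.union_subset_union (Set.sdiff_subset_sdiff_left hYN) hK'
    have IH := ih (U.erase v) hss M M' MM ((X \ {v}) ∪ K) ((Y \ {v}) ∪ K') ((N \ {v}) ∪ Kset U E v)
      haU' hMMU' hN1 hM hM' hX1 hY1
    -- factor 2: `((M′ ∪ Y) ∖ v) ∪ K′ = M′ ∪ Y^{K′}` as `v ∉ M′`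
    have h2 : evQp (U.erase v) E F a (((M' ∪ Y) \ {v}) ∪ K') MM ((N \ {v}) ∪ Kset U E v) =
        evQp (U.erase v) E F a (M' ∪ ((Y \ {v}) ∪ K')) MM ((N \ {v}) ∪ Kset U E v) := by
      congr 1
      ext d
      simp only [Set.mem_union, Set.mem_sdiff, Set.mem_singleton_iff]
      constructor
      · rintro (⟨hd | hd, hdv⟩ | hd)
        · exact Or.inl hd
        · exact Or.inr (Or.inl ⟨hd, hdv⟩)
        · exact Or.inr (Or.inr hd)
      · rintro (hd | ⟨hd, hdv⟩ | hd)
        · exact Or.inl ⟨Or.inl hd, fun h => hvM' (h ▸ hd)⟩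
        · exact Or.inl ⟨Or.inr hd, hdv⟩
        · exact Or.inr hd
    -- factor 3: antitone
    have h3 : PrW D p (evXi (U.erase v) F a (M ∪ M') (((X \ {v}) ∪ K) ∩ ((Y \ {v}) ∪ K'))) ≤
        PrW D p (evXi (U.erase v) F a (M ∪ M') (((X ∩ Y) \ {v}) ∪ (K ∩ K'))) := by
      refine PrW_mono D hp0 hp1 fun S _ hS => evXi_anti ?_ hS
      rintro d (⟨⟨hdX, hdY⟩, hdv⟩ | ⟨hdK, hdK'⟩)
      · exact ⟨Or.inl ⟨hdX, hdv⟩, Or.inl ⟨hdY, hdv⟩⟩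
      · exact ⟨Or.inr hdK, Or.inr hdK'⟩
    -- factor 4: equal hubs
    have h4 : evXi (U.erase v) F a (((X \ {v}) ∪ K) ∪ ((Y \ {v}) ∪ K')) (M ∩ M') =
        evXi (U.erase v) F a (((X ∪ Y) \ {v}) ∪ (K ∪ K')) (M ∩ M') := by
      congr 1
      ext d
      simp only [Set.mem_union, Set.mem_sdiff, Set.mem_singleton_iff]
      tauto
    show PrW D p (evT (U.erase v) F a M ((X \ {v}) ∪ K)) *
        PrW D p (evQp (U.erase v) E F a (((M' ∪ Y) \ {v}) ∪ K') MM ((N \ {v}) ∪ Kset U E v)) ≤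
      PrW D p (evXi (U.erase v) F a (M ∪ M') (((X ∩ Y) \ {v}) ∪ (K ∩ K'))) *
        PrW D p (evXi (U.erase v) F a (((X ∪ Y) \ {v}) ∪ (K ∪ K')) (M ∩ M'))
    rw [h2, ← h4]
    exact IH.trans (mul_le_mul_of_nonneg_right h3 (hnn _))
  /- The exchange symmetry. -/
  have symm : ∀ (M M' MM X Y N : Set V),
      PrW D p (evT U F a X M) * PrW D p (evQp U E F a (Y ∪ M') N MM) ≤
        PrW D p (evXi U F a (X ∪ Y) (M ∩ M')) * PrW D p (evXi U F a (M ∪ M') (X ∩ Y)) →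
      PrW D p (evT U F a M X) * PrW D p (evQp U E F a (M' ∪ Y) MM N) ≤
        PrW D p (evXi U F a (M ∪ M') (X ∩ Y)) * PrW D p (evXi U F a (X ∪ Y) (M ∩ M')) := by
    intro M M' MM X Y N h
    rw [evT_comm M X, evQp_swap U M' Y MM N, mul_comm (PrW D p (evXi U F a (M ∪ M') (X ∩ Y)))]
    exact h
  /- Step: `X ∩ Y` or `M ∩ M′` nonempty. -/
  have step : ∀ (M M' MM X Y N : Set V), a ∈ U → MM ⊆ ↑U → N ⊆ ↑U → M ⊆ MM → M' ⊆ MM → X ⊆ N →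
      Y ⊆ N → ((X ∩ Y) ∪ (M ∩ M')).Nonempty →
      PrW D p (evT U F a M X) * PrW D p (evQp U E F a (M' ∪ Y) MM N) ≤
        PrW D p (evXi U F a (M ∪ M') (X ∩ Y)) * PrW D p (evXi U F a (X ∪ Y) (M ∩ M')) := by
    intro M M' MM X Y N haU hMMU hNU hM hM' hXN hYN hne
    have hRHS : 0 ≤ PrW D p (evXi U F a (M ∪ M') (X ∩ Y)) * PrW D p (evXi U F a (X ∪ Y) (M ∩ M')) :=
      mul_nonneg (hnn _) (hnn _)
    by_cases hc : ∃ v, v ∈ X ∧ v ∈ Y ∧ v ∉ MM ∧ v ≠ a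
    · obtain ⟨v, hvX, hvY, hvMM, hva⟩ := hc
      exact peel_c M M' MM X Y N haU hMMU hNU hM hM' hXN hYN v hvX hvY hvMM hva
    by_cases hb : ∃ v, v ∈ M ∧ v ∈ M' ∧ v ∉ N ∧ v ≠ a
    · obtain ⟨v, hvM, hvM', hvN, hva⟩ := hb
      exact symm M M' MM X Y N (peel_c X Y N M M' MM haU hNU hMMU hXN hYN hM hM' v hvM hvM' hvN hva)
    -- degenerate: factor 2 vanishes
    push Not at hc hb
    have h0 : PrW D p (evQp U E F a (M' ∪ Y) MM N) = 0 := by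
      refine PrW_eq_zero_of_forall_not_mem D p fun S => ?_
      obtain ⟨v, hv⟩ := hne
      rcases hv with ⟨hvX, hvY⟩ | ⟨hvM, hvM'⟩
      · by_cases hvMM : v ∈ MM
        · exact not_mem_evQp_of_mem_inter (Set.mem_union_right M' hvY) hvMM (hYN hvY) S
        · have hva : v = a := hc v hvX hvY hvMM
          subst hva
          exact not_mem_evQp_of_mem (Set.mem_union_right M' hvY) S
      · by_cases hvN : v ∈ N
        · exact not_mem_evQp_of_mem_inter (Set.mem_union_left Y hvM') (hM' hvM') hvN S
        · have hva : v = a := hb v hvM hvM' hvN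
          subst hva
          exact not_mem_evQp_of_mem (Set.mem_union_left Y hvM') S
    rw [h0, mul_zero]
    exact hRHS
  /- All parameters. -/
  intro M M' MM X Y N haU hMMU hNU hM hM' hXN hYN
  by_cases hne : ((X ∩ Y) ∪ (M ∩ M')).Nonempty
  · exact step M M' MM X Y N haU hMMU hNU hM hM' hXN hYN hne
  have hne' : (X ∩ Y) ∪ (M ∩ M') = ∅ := Set.not_nonempty_iff_eq_empty.1 hne
  have hZe : X ∩ Y = ∅ := Set.subset_eq_empty Set.subset_union_left hne'
  have hBe : M ∩ M' = ∅ := Set.subset_eq_empty Set.subset_union_right hne'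
  rw [hZe, hBe]
  have hMU : M ⊆ ↑U := hM.trans hMMU
  have hXU : X ⊆ ↑U := hXN.trans hNU
  -- the right-hand side dominates `h(M) h(X)`
  have hR : PrW D p (evXi U F a M ∅) * PrW D p (evXi U F a X ∅) ≤
      PrW D p (evXi U F a (M ∪ M') ∅) * PrW D p (evXi U F a (X ∪ Y) ∅) :=
    mul_le_mul (PrW_mono D hp0 hp1 fun S _ hS => evXi_empty_mono Set.subset_union_left hS)
      (PrW_mono D hp0 hp1 fun S _ hS => evXi_empty_mono Set.subset_union_left hS) (hnn _) (hnn _)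
  -- the left-hand side is at most `t · s`
  have hL : PrW D p (evQp U E F a (M' ∪ Y) MM N) ≤ PrW D p {S : Finset (Sym2 V) | S ∪ F ∈ sepEv U E a M X} := by
    refine PrW_mono D hp0 hp1 fun S _ hS => ?_
    have h : S ∪ F ∈ sepEv U E a M X := sepEv_anti hM hXN hS.2
    exact h
  set s := PrW D p {S : Finset (Sym2 V) | S ∪ F ∈ sepEv U E a M X} with hs
  set t := PrW D p (evT U F a M X) with ht_def
  have ht0 : 0 ≤ t := hnn _
  -- names for the base-type algebra
  set α := PrW D p (evE4 U F a M X) with hα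
  set β := PrW D p (evE4 U F a X M) with hβ
  set ΞM := PrW D p (evXi U F a M X) with hΞM
  set ΞX := PrW D p (evXi U F a X M) with hΞX
  set q₀ := PrW D p (evQp U E F a (M ∪ X) M X) with hq₀
  set g₁ := PrW D p (evE2 U E F a M X X) with hg₁
  set g₂ := PrW D p (evE2 U E F a X M M) with hg₂
  set g₃ := PrW D p {S | (∃ m ∈ M, (sG U (S ∪ F) ∅ ∅).Reachable a m) ∧
      (∃ x ∈ X, (sG U (S ∪ F) ∅ ∅).Reachable a x) ∧ S ∪ F ∈ sepEv U E a M X} with hg₃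
  -- `s ≤ q₀ + g₁ + g₂ + g₃`
  have hs4 : s ≤ q₀ + g₁ + g₂ + g₃ := by
    have hsub : ∀ S : Finset (Sym2 V), S ⊆ D → S ∈ {S : Finset (Sym2 V) | S ∪ F ∈ sepEv U E a M X} →
        S ∈ evQp U E F a (M ∪ X) M X ∪ (evE2 U E F a M X X ∪ (evE2 U E F a X M M ∪
          {S | (∃ m ∈ M, (sG U (S ∪ F) ∅ ∅).Reachable a m) ∧
            (∃ x ∈ X, (sG U (S ∪ F) ∅ ∅).Reachable a x) ∧ S ∪ F ∈ sepEv U E a M X})) := by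
      intro S _ hS
      simp only [Set.mem_union]
      rcases (mem_sep_split M X).1 hS with h | h | h | h
      · exact Or.inl h
      · exact Or.inr (Or.inl h)
      · exact Or.inr (Or.inr (Or.inl h))
      · exact Or.inr (Or.inr (Or.inr h))
    have e1 : s ≤ PrW D p (evQp U E F a (M ∪ X) M X ∪ (evE2 U E F a M X X ∪ (evE2 U E F a X M M ∪
        {S | (∃ m ∈ M, (sG U (S ∪ F) ∅ ∅).Reachable a m) ∧
          (∃ x ∈ X, (sG U (S ∪ F) ∅ ∅).Reachable a x) ∧ S ∪ F ∈ sepEv U E a M X}))) :=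
      PrW_mono D hp0 hp1 hsub
    have e2 : PrW D p (evQp U E F a (M ∪ X) M X ∪ (evE2 U E F a M X X ∪ (evE2 U E F a X M M ∪
        {S | (∃ m ∈ M, (sG U (S ∪ F) ∅ ∅).Reachable a m) ∧
          (∃ x ∈ X, (sG U (S ∪ F) ∅ ∅).Reachable a x) ∧ S ∪ F ∈ sepEv U E a M X}))) ≤
        q₀ + PrW D p (evE2 U E F a M X X ∪ (evE2 U E F a X M M ∪
          {S | (∃ m ∈ M, (sG U (S ∪ F) ∅ ∅).Reachable a m) ∧
            (∃ x ∈ X, (sG U (S ∪ F) ∅ ∅).Reachable a x) ∧ S ∪ F ∈ sepEv U E a M X})) :=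
      PrW_union_le D hp0 hp1 _ _
    have e3 : PrW D p (evE2 U E F a M X X ∪ (evE2 U E F a X M M ∪
        {S | (∃ m ∈ M, (sG U (S ∪ F) ∅ ∅).Reachable a m) ∧
          (∃ x ∈ X, (sG U (S ∪ F) ∅ ∅).Reachable a x) ∧ S ∪ F ∈ sepEv U E a M X})) ≤
        g₁ + PrW D p (evE2 U E F a X M M ∪
          {S | (∃ m ∈ M, (sG U (S ∪ F) ∅ ∅).Reachable a m) ∧
            (∃ x ∈ X, (sG U (S ∪ F) ∅ ∅).Reachable a x) ∧ S ∪ F ∈ sepEv U E a M X}) :=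
      PrW_union_le D hp0 hp1 _ _
    have e4 : PrW D p (evE2 U E F a X M M ∪
        {S | (∃ m ∈ M, (sG U (S ∪ F) ∅ ∅).Reachable a m) ∧
          (∃ x ∈ X, (sG U (S ∪ F) ∅ ∅).Reachable a x) ∧ S ∪ F ∈ sepEv U E a M X}) ≤ g₂ + g₃ :=
      PrW_union_le D hp0 hp1 _ _
    linarith
  -- the four brackets
  have hd : t * q₀ ≤ ΞM * ΞX := by
    by_cases hXe : X.Nonempty
    · obtain ⟨x, hx⟩ := hXe
      have h := step M M M X X X haU hMU hXU le_rfl le_rfl le_rfl le_rfl ⟨x, Or.inl ⟨hx, hx⟩⟩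
      rwa [Set.union_self, Set.inter_self, Set.union_self, Set.inter_self] at h
    · have hXe' : X = ∅ := Set.not_nonempty_iff_eq_empty.1 hXe
      have ht0' : t = 0 := by
        rw [ht_def]
        refine PrW_eq_zero_of_forall_not_mem D p fun S hS => ?_
        obtain ⟨x, hx, _⟩ := hS.2
        rw [hXe'] at hx
        exact hx
      rw [ht0', zero_mul]
      exact mul_nonneg (hnn _) (hnn _)
  have h1 : t * g₁ ≤ ΞM * β := by
    have h := ea_univ hp0 hp1 hDE hFE U M X X X haU hMU hXU le_rfl le_rfl
    rwa [Set.inter_self, Set.union_self] at h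
  have h2 : t * g₂ ≤ ΞX * α := by
    have h := ea_univ hp0 hp1 hDE hFE U X M M M haU hXU hMU le_rfl le_rfl
    rwa [Set.inter_self, Set.union_self, ← evT_comm M X] at h
  have h3 : t * g₃ ≤ α * β := t_mul_g3_le hp0 hp1 U M X
  have hsM : PrW D p (evXi U F a M ∅) = ΞM + α := PrW_evXi_empty_split U M X
  have hsX : PrW D p (evXi U F a X ∅) = ΞX + β := PrW_evXi_empty_split U X M
  -- assemble
  calc t * PrW D p (evQp U E F a (M' ∪ Y) MM N)
      ≤ t * s := mul_le_mul_of_nonneg_left hL ht0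
    _ ≤ t * (q₀ + g₁ + g₂ + g₃) := mul_le_mul_of_nonneg_left hs4 ht0
    _ = t * q₀ + t * g₁ + t * g₂ + t * g₃ := by ring
    _ ≤ ΞM * ΞX + ΞM * β + ΞX * α + α * β := add_le_add (add_le_add (add_le_add hd h1) h2) h3
    _ = (ΞM + α) * (ΞX + β) := by ring
    _ = PrW D p (evXi U F a M ∅) * PrW D p (evXi U F a X ∅) := by rw [hsM, hsX]
    _ ≤ PrW D p (evXi U F a (M ∪ M') ∅) * PrW D p (evXi U F a (X ∪ Y) ∅) := hR

/-- **`BT₀`**: `t(M,X) · P(C_a separates M from X) ≤ h(M) · h(X)` for all `M, X ⊆ U` (`a ∈ U`). [this work] -/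
theorem bt0 (hp0 : ∀ e, 0 ≤ p e) (hp1 : ∀ e, p e ≤ 1) (hDE : D ⊆ E) (hFE : F ⊆ E) (U : Finset V)
    {M X : Set V} (haU : a ∈ U) (hMU : M ⊆ ↑U) (hXU : X ⊆ ↑U) :
    PrW D p (evT U F a M X) * PrW D p {S : Finset (Sym2 V) | S ∪ F ∈ sepEv U E a M X} ≤
      PrW D p (evXi U F a M ∅) * PrW D p (evXi U F a X ∅) := by
  have h := master_univ hp0 hp1 hDE hFE U M ∅ M X ∅ X haU hMU hXU le_rfl (Set.empty_subset M) le_rfl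
    (Set.empty_subset X)
  rw [Set.union_empty, Set.union_empty, Set.inter_empty, Set.inter_empty, Set.union_empty] at h
  have h2 : PrW D p {S : Finset (Sym2 V) | S ∪ F ∈ sepEv U E a M X} = PrW D p (evQp U E F a ∅ M X) := by
    congr 1
    ext S
    simp only [Set.mem_setOf_eq, mem_evQp, Set.mem_empty_iff_false, false_implies, implies_true, true_and]
  rw [h2]
  exact h

/-- **`BT₀` for plain hitting events** (census law `G1`): `P(C_a meets M and X) · P(C_a separates M from X) ≤ h(M) · h(X)`,
since the glued event `t(M,X)` contains `{hM ∧ hX}`. [this work] -/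
theorem bt0_hits (hp0 : ∀ e, 0 ≤ p e) (hp1 : ∀ e, p e ≤ 1) (hDE : D ⊆ E) (hFE : F ⊆ E) (U : Finset V)
    {M X : Set V} (haU : a ∈ U) (hMU : M ⊆ ↑U) (hXU : X ⊆ ↑U) :
    PrW D p {S : Finset (Sym2 V) | (∃ m ∈ M, (sG U (S ∪ F) ∅ ∅).Reachable a m) ∧
        ∃ x ∈ X, (sG U (S ∪ F) ∅ ∅).Reachable a x} *
      PrW D p {S : Finset (Sym2 V) | S ∪ F ∈ sepEv U E a M X} ≤
      PrW D p (evXi U F a M ∅) * PrW D p (evXi U F a X ∅) := by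
  have h1 : PrW D p {S : Finset (Sym2 V) | (∃ m ∈ M, (sG U (S ∪ F) ∅ ∅).Reachable a m) ∧
      ∃ x ∈ X, (sG U (S ∪ F) ∅ ∅).Reachable a x} ≤ PrW D p (evT U F a M X) :=
    PrW_mono D hp0 hp1 fun S _ hS => (mem_evT_iff_evE4_or M X).2 (Or.inl (mem_evE4_of_hits hS.1 hS.2))
  exact (mul_le_mul_of_nonneg_right h1 (PrW_nonneg D hp0 hp1 _)).trans (bt0 hp0 hp1 hDE hFE U haU hMU hXU)

end Master

end DualBHK

end Summit.CriticalPhenomena.PercolationContinuityZ3.Theorems
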